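import Literature.NumberTheory.EllipticCurves.PrimeConductorTwoTorsionNormalFormProofs
import Literature.NumberTheory.EllipticCurves.NeumannSetzerCurves
import Literature.NumberTheory.DiophantineGeometry.LebesgueNagellSixtyFour
import Mathlib.NumberTheory.Multiplicity
import Mathlib.RingTheory.PrincipalIdealDomain
import HarnessLib

/-!
# Setzer's theorem: elliptic curves of prime conductor with a rational point of order `2`

Topic `Literature/NumberTheory/EllipticCurves`; namespace `Literature.NumberTheory.EllipticCurves`
(lemmas in the sub-namespace `PrimeConductorTwoTorsion`). THEOREMS ONLY — no definition, no named
fact (D-0026). This file DISCHARGES the named fact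
`Literature.NumberTheory.EllipticCurves.Setzer1975_primeConductor_rationalTwoTorsion`
(`NeumannSetzerCurves.lean`):

* `Setzer1975_primeConductor_rationalTwoTorsion_holds` — **Setzer's theorem** [Setzer1975, Thm 2]
  (as restated in [Ivorra2004, Introduction, Théorème p. 5]; cf. [Mazur1977, III §7 p. 162]): an
  elliptic curve `E/ℚ` of PRIME conductor `p` with a rational point of order `2` has `p = 17`, or
  `p = u² + 64` with `u ≡ 3 (mod 4)` and `E` is `ℚ`-isomorphic to one of the two Neumann–Setzer curves
  `E₀(u) : y² + xy = x³ − (u+1)/4·x² + 4x − u`, `E₁(u) : y² + xy = x³ − (u+1)/4·x² − x`.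
* `exists_smul_eq_of_conductorNorm_eq_seventeen` — the complement at `p = 17` [Setzer1975, Thm 2
  and the table of conductor 17] [Cremona1997, Table 1, N = 17]: an elliptic curve of conductor `17`
  with a rational point of order `2` is `ℚ`-isomorphic to one of `17a1 = [1,−1,1,−1,−14]`,
  `17a2 = [1,−1,1,−6,−4]`, `17a3 = [1,−1,1,−91,−310]`, `17a4 = [1,−1,1,−1,0]`.

## The proof (Setzer's argument, [Setzer1975, §2]; [Ivorra2004, §2])

By `PrimeConductorTwoTorsion.exists_normalForm_of_prime_conductorNorm`
(`PrimeConductorTwoTorsionNormalFormProofs.lean`) the curve is `y² = x³ + Ax² + Bx` with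
`A, B ∈ ℤ`, `B²(A² − 4B) = ±2⁸pⁿ` (`n ≥ 1`), `p ∤ A² − 3B`, of `2`-adic type I (`A ≡ 1 (mod 4)`,
`8 ∣ B`) or II (`B` odd, `A = 2A₁`, `A₁ ≡ 3 (mod 4)`).

* §1 arithmetic lemmas: an odd divisor of `2ᵏ` is `±1`; `a(a+1) ≠ ±2ᵏ` (`k ≥ 2`); the two
  "difference of squares" equations `(A − 8)(A + 8) = ±pˡ ⟹ p = 17, A = ±9` and
  `(A − 1)(A + 1) = ±64pˡ ⟹ p = 17, A = ±33` (`p` an odd prime; `p` cannot divide both factors, so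
  `pˡ` divides one of them and the cofactor equation is bounded).
* §2 type I (`classify_typeI`): `B = 16B₀` (parity), `B₀²(A² − 64B₀) = ±pⁿ`; `p = 2` is impossible;
  for odd `p`, `p ∤ A² − 48B₀` forbids `p ∣ B₀` and `p ∣ A² − 64B₀` simultaneously, whence
  `B₀ = ±1` (`A² ∓ 64 = ±pⁿ`: `p = 17` with `(A, B) = (9, 16)`, or — by the Lebesgue–Nagell equation
  `A² + 64 = pⁿ ⟹ n = 1 ∨ (n, p) = (2, 17)` (`LebesgueNagellSixtyFour.lean`) — the Neumann–Setzer
  case `p = A² + 64`, `B = −16`, or `(A, B) = (−15, −16)` at `17`), or `A² − 64B₀ = ±1`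
  (`(A − 1)(A + 1) = ±64pʲ`: `(A, B) = (33, 272)` at `17`).
* §3 type II (`classify_typeII`): `B²(A₁² − B) = ±64pⁿ`; `p = 2` is impossible; for odd `p` either
  `B = ±1` (`(A₁ − 1)(A₁ + 1) = ±64pⁿ`: `(A, B) = (−66, 1)` at `17`; `A₁² + 1 ≢ 0 (mod 4)`), or
  `A₁² − B = ±64` with `B = ±pʲ` (`A₁² − 64 = ±pʲ`: `(A, B) = (−18, 17)` at `17`; `A₁² + 64 = pʲ`:
  the Neumann–Setzer case `p = A₁² + 64`, `(A, B) = (2u, u² + 64)`, or `(A, B) = (30, 289)` at `17`).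
* §4 the explicit isomorphisms (`exists_smul_eq_of_twoTorsionModel`: the target curve's own
  `2`-torsion normal form, `PrimeConductorTwoTorsion.smul_eq_twoTorsionModel`):
  `⟨0, −u, 0, −16, 0⟩ ≅ E₁(u)`, `⟨0, 2u, 0, u² + 64, 0⟩ ≅ E₀(u)`, and at `17`:
  `(9, 16) ≅ 17a4`, `(30, 289) ≅ 17a1`, `(−66, 1) ≅ 17a3`, `(−15, −16), (33, 272), (−18, 17) ≅ 17a2`
  (the three points of order `2` of `17a2`).

## References

* [Setzer1975] B. Setzer, *Elliptic curves of prime conductor*, J. London Math. Soc. (2) 10 (1975)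
  367–378, Theorem 2 (not held — acq-03412; statement from [Ivorra2004]).
* [Ivorra2004] W. Ivorra, *Courbes elliptiques sur ℚ, ayant un point d'ordre 2 rationnel sur ℚ, de
  conducteur 2ᴺp*, Dissertationes Math. 429 (2004), Introduction p. 5 (Setzer's theorem restated,
  the four curves of conductor 17). Held: `paper:doi-10-4064-dm429-0-1`.
* [Mazur1977] B. Mazur, *Modular curves and the Eisenstein ideal*, Publ. Math. IHÉS 47 (1977),
  III §7 (p. 162: Neumann–Setzer curves; "N = 17").
* [Cremona1997] J. E. Cremona, *Algorithms for Modular Elliptic Curves*, 2nd ed., CUP 1997, Table 1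
  (N = 17: 17a1–17a4).
* [Cohn1993] J. H. E. Cohn, *The Diophantine equation x² + C = yⁿ*, Acta Arith. 65 (1993) 367–381
  (the case `C = 64`).
-/

namespace Literature.NumberTheory.EllipticCurves

namespace PrimeConductorTwoTorsion

open WeierstrassCurve Greenberg1999

/-! ## §1 Arithmetic lemmas -/

/-- An odd divisor of a power of `2` is `±1`. [folklore] -/
private theorem odd_dvd_two_pow {d : ℤ} (hd : Odd d) {k : ℕ} (h : d ∣ (2 : ℤ) ^ k) :
    d = 1 ∨ d = -1 := by
  have h1 : d.natAbs ∣ 2 ^ k := by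
    have := Int.natAbs_dvd_natAbs.mpr h
    simpa [Int.natAbs_pow] using this
  obtain ⟨i, -, hi⟩ := (Nat.dvd_prime_pow Nat.prime_two).mp h1
  have hi0 : i = 0 := by
    by_contra hne
    have h2 : 2 ∣ d.natAbs := by rw [hi]; exact dvd_pow_self 2 hne
    have hodd : Odd d.natAbs := Int.natAbs_odd.mpr hd
    exact (Nat.not_even_iff_odd.mpr hodd) (even_iff_two_dvd.mpr h2)
  rw [hi0, pow_zero] at hi
  exact Int.natAbs_eq_iff.mp hi

/-- `a(a + 1) = ±2ᵏ` is impossible for `k ≥ 2` (one of `a`, `a + 1` is an odd divisor of `2ᵏ`).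
[folklore] -/
private theorem mul_succ_ne_two_pow {a : ℤ} {k : ℕ} (hk : 2 ≤ k)
    (h : a * (a + 1) = 2 ^ k ∨ a * (a + 1) = -(2 ^ k)) : False := by
  have h4 : (4 : ℤ) ≤ 2 ^ k := by
    calc (4 : ℤ) = 2 ^ 2 := by norm_num
      _ ≤ 2 ^ k := pow_le_pow_right₀ (by norm_num) hk
  have hprod : a * (a + 1) ∣ (2 : ℤ) ^ k := by
    rcases h with h | h
    · exact ⟨1, by rw [h, mul_one]⟩
    · exact ⟨-1, by rw [← neg_eq_iff_eq_neg.mpr h]; ring⟩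
  rcases Int.even_or_odd a with ha | ha
  · have hodd : Odd (a + 1) := ha.add_one
    rcases odd_dvd_two_pow hodd ((Dvd.intro_left _ rfl).trans hprod) with h1 | h1
    · have ha0 : a = 0 := by omega
      rw [ha0] at h; omega
    · have ha0 : a = -2 := by omega
      rw [ha0] at h; omega
  · rcases odd_dvd_two_pow ha ((Dvd.intro _ rfl).trans hprod) with h1 | h1
    · rw [h1] at h; omega
    · rw [h1] at h; omega

/-- `pˡ = 17` for a prime `p` forces `p = 17` (and `l = 1`). [folklore] -/
private theorem eq_seventeen_of_pow_eq {N l : ℕ} (h : (N : ℤ) ^ l = 17) :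
    N = 17 ∧ l = 1 := by
  have h' : N ^ l = 17 := by exact_mod_cast h
  exact (Nat.Prime.pow_eq_iff (by norm_num)).mp h'

/-- `pˡ ≠ 15` for a prime `p`. [folklore] -/
private theorem pow_ne_fifteen {N l : ℕ} (hN : N.Prime) (h : (N : ℤ) ^ l = 15) : False := by
  have h' : N ^ l = 15 := by exact_mod_cast h
  have h3 : 3 ∣ N := Nat.prime_three.dvd_of_dvd_pow (n := l) (by rw [h']; norm_num)
  have h5 : 5 ∣ N := Nat.prime_five.dvd_of_dvd_pow (n := l) (by rw [h']; norm_num)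
  have e3 := (Nat.prime_dvd_prime_iff_eq Nat.prime_three hN).mp h3
  have e5 := (Nat.prime_dvd_prime_iff_eq Nat.prime_five hN).mp h5
  omega

/-- A divisor (up to sign) of a prime power `pⁿ` is `±pʲ`. [folklore] -/
private theorem eq_pow_or_neg_pow_of_dvd {N : ℕ} (hN : N.Prime) {b : ℤ} {n : ℕ}
    (h : b ∣ (N : ℤ) ^ n) : ∃ j : ℕ, b = (N : ℤ) ^ j ∨ b = -((N : ℤ) ^ j) := by
  have h1 : b.natAbs ∣ N ^ n := by
    have := Int.natAbs_dvd_natAbs.mpr h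
    simpa [Int.natAbs_pow] using this
  obtain ⟨j, -, hj⟩ := (Nat.dvd_prime_pow hN).mp h1
  refine ⟨j, ?_⟩
  have := Int.natAbs_eq_iff.mp hj
  push_cast at this
  exact this

/-- **Key divisibility step.** If `x·y = K·pˡ` for a prime `p` that does not divide both `x` and
`y`, then `pˡ` divides one of the two factors and the cofactor equation holds. [folklore] -/
private theorem exists_cofactor {p : ℤ} (hp : Prime p) {x y K : ℤ} {l : ℕ}
    (h : x * y = K * p ^ l) (hxy : ¬ (p ∣ x ∧ p ∣ y)) :
    ∃ m : ℤ, (x = p ^ l * m ∧ m * y = K) ∨ (y = p ^ l * m ∧ x * m = K) := by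
  rcases Nat.eq_zero_or_pos l with hl | _
  · subst hl
    exact ⟨x, Or.inl ⟨by ring, by simpa using h⟩⟩
  have hdvd : p ^ l ∣ x * y := ⟨K, by rw [h]; ring⟩
  have hp0 : p ^ l ≠ 0 := pow_ne_zero _ hp.ne_zero
  by_cases hx : p ∣ x
  · have hy : ¬ p ∣ y := fun hy => hxy ⟨hx, hy⟩
    obtain ⟨m, hm⟩ := hp.pow_dvd_of_dvd_mul_right l hy hdvd
    refine ⟨m, Or.inl ⟨hm, mul_left_cancel₀ hp0 ?_⟩⟩
    linear_combination h - y * hm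
  · obtain ⟨m, hm⟩ := hp.pow_dvd_of_dvd_mul_left l hx hdvd
    refine ⟨m, Or.inr ⟨hm, mul_left_cancel₀ hp0 ?_⟩⟩
    linear_combination h - x * hm

/-- `(A − 8)(A + 8) = ±pˡ` with `p` an odd prime forces `p = 17`, `A = ±9`. [folklore] -/
private theorem sq_sub_sixtyfour {N : ℕ} (hN : N.Prime) (hN2 : N ≠ 2) {A : ℤ} {l : ℕ}
    (h : (A - 8) * (A + 8) = (N : ℤ) ^ l ∨ (A - 8) * (A + 8) = -((N : ℤ) ^ l)) :
    N = 17 ∧ (A = 9 ∨ A = -9) := by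
  have hp : Prime (N : ℤ) := Nat.prime_iff_prime_int.mp hN
  have hpos : (0 : ℤ) < (N : ℤ) ^ l := pow_pos (by exact_mod_cast hN.pos) l
  have hxy : ¬ ((N : ℤ) ∣ A - 8 ∧ (N : ℤ) ∣ A + 8) := by
    rintro ⟨h1, h2⟩
    have h16 : (N : ℤ) ∣ 2 ^ 4 := by
      have := dvd_sub h2 h1
      ring_nf at this ⊢
      exact this
    have h16' : N ∣ 2 ^ 4 := by exact_mod_cast h16
    exact hN2 ((Nat.prime_dvd_prime_iff_eq hN Nat.prime_two).mp (hN.dvd_of_dvd_pow h16'))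
  -- normalise the sign into a constant `K = ±1`
  obtain ⟨K, hK, hKval⟩ : ∃ K : ℤ, (A - 8) * (A + 8) = K * (N : ℤ) ^ l ∧ (K = 1 ∨ K = -1) := by
    rcases h with h | h
    · exact ⟨1, by rw [h]; ring, Or.inl rfl⟩
    · exact ⟨-1, by rw [h]; ring, Or.inr rfl⟩
  obtain ⟨m, hm⟩ := exists_cofactor hp hK hxy
  generalize hM : (N : ℤ) ^ l = M at hm hpos
  have key : M = 17 ∧ (A = 9 ∨ A = -9) ∨ M = 15 := by
    rcases hm with ⟨h1, h2⟩ | ⟨h1, h2⟩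
    · -- `m (A + 8) = ±1`
      rcases hKval with rfl | rfl
      · rcases Int.eq_one_or_neg_one_of_mul_eq_one' h2 with ⟨rfl, h3⟩ | ⟨rfl, h3⟩ <;> omega
      · rcases Int.eq_one_or_neg_one_of_mul_eq_neg_one' h2 with ⟨rfl, h3⟩ | ⟨rfl, h3⟩ <;> omega
    · rcases hKval with rfl | rfl
      · rcases Int.eq_one_or_neg_one_of_mul_eq_one' h2 with ⟨h3, rfl⟩ | ⟨h3, rfl⟩ <;> omega
      · rcases Int.eq_one_or_neg_one_of_mul_eq_neg_one' h2 with ⟨h3, rfl⟩ | ⟨h3, rfl⟩ <;> omega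
  rcases key with ⟨hM17, hA⟩ | hM15
  · exact ⟨(eq_seventeen_of_pow_eq (hM.trans hM17)).1, hA⟩
  · exact (pow_ne_fifteen hN (hM.trans hM15)).elim

/-- `(A − 1)(A + 1) = ±64pˡ` with `p` an odd prime forces `p = 17`, `A = ±33`. [folklore] -/
private theorem sq_sub_one {N : ℕ} (hN : N.Prime) (hN2 : N ≠ 2) {A : ℤ} {l : ℕ}
    (h : (A - 1) * (A + 1) = 64 * (N : ℤ) ^ l ∨ (A - 1) * (A + 1) = -(64 * (N : ℤ) ^ l)) :
    N = 17 ∧ (A = 33 ∨ A = -33) := by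
  have hp : Prime (N : ℤ) := Nat.prime_iff_prime_int.mp hN
  have hpos : (0 : ℤ) < (N : ℤ) ^ l := pow_pos (by exact_mod_cast hN.pos) l
  have hodd : ((N : ℤ) ^ l) % 2 = 1 :=
    Int.odd_iff.mp ((Int.odd_coe_nat N).mpr (hN.odd_of_ne_two hN2)).pow
  have hxy : ¬ ((N : ℤ) ∣ A - 1 ∧ (N : ℤ) ∣ A + 1) := by
    rintro ⟨h1, h2⟩
    have h2' : (N : ℤ) ∣ 2 ^ 1 := by
      have := dvd_sub h2 h1
      ring_nf at this ⊢
      exact this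
    have h2'' : N ∣ 2 ^ 1 := by exact_mod_cast h2'
    exact hN2 ((Nat.prime_dvd_prime_iff_eq hN Nat.prime_two).mp (hN.dvd_of_dvd_pow h2''))
  obtain ⟨K, hK, hKval⟩ :
      ∃ K : ℤ, (A - 1) * (A + 1) = K * (N : ℤ) ^ l ∧ (K = 64 ∨ K = -64) := by
    rcases h with h | h
    · exact ⟨64, by rw [h], Or.inl rfl⟩
    · exact ⟨-64, by rw [h]; ring, Or.inr rfl⟩
  obtain ⟨m, hm⟩ := exists_cofactor hp hK hxy
  have hmdvd : m ∣ 64 := by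
    have hmK : m ∣ K := by
      rcases hm with ⟨-, h2⟩ | ⟨-, h2⟩
      · exact Dvd.intro _ h2
      · exact Dvd.intro_left _ h2
    rcases hKval with rfl | rfl
    · exact hmK
    · exact (dvd_neg.mp hmK)
  have hm1 : m ≤ 64 := Int.le_of_dvd (by norm_num) hmdvd
  have hm2 : -64 ≤ m := by have := Int.le_of_dvd (by norm_num) (neg_dvd.mpr hmdvd); omega
  generalize hM : (N : ℤ) ^ l = M at hm hpos hodd
  have key : M = 17 ∧ (A = 33 ∨ A = -33) ∨ M = 15 := by
    rcases hm with ⟨h1, h2⟩ | ⟨h1, h2⟩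
    · have h3 : m * (M * m + 2) = K := by linear_combination h2 - m * h1
      rcases hKval with rfl | rfl <;> interval_cases m <;> omega
    · have h3 : m * (M * m - 2) = K := by linear_combination h2 - m * h1
      rcases hKval with rfl | rfl <;> interval_cases m <;> omega
  rcases key with ⟨hM17, hA⟩ | hM15
  · exact ⟨(eq_seventeen_of_pow_eq (hM.trans hM17)).1, hA⟩
  · exact (pow_ne_fifteen hN (hM.trans hM15)).elim

/-- `A² = 225 ⟹ A = ±15`. [folklore] -/
private theorem eq_of_sq_eq_225 {A : ℤ} (h : A ^ 2 = 225) : A = 15 ∨ A = -15 := by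
  have : (A - 15) * (A + 15) = 0 := by linear_combination h
  rcases mul_eq_zero.mp this with h1 | h1
  · left; linarith
  · right; linarith

/-! ## §2 Type I: `A ≡ 1 (mod 4)`, `8 ∣ B` -/

/-- **Type I classification.** [cite: Setzer1975, Thm 2 (proof, the case of a `2`-torsion model with `16 ∣ B`); cf. Ivorra2004, §2] -/
theorem classify_typeI {N : ℕ} (hN : N.Prime) {A B : ℤ} {n : ℕ} (hn : 1 ≤ n)
    (hD : B ^ 2 * (A ^ 2 - 4 * B) = 2 ^ 8 * (N : ℤ) ^ n ∨
      B ^ 2 * (A ^ 2 - 4 * B) = -(2 ^ 8 * (N : ℤ) ^ n))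
    (hC : ¬ (N : ℤ) ∣ A ^ 2 - 3 * B) (hA : A % 4 = 1) (hB : (8 : ℤ) ∣ B) :
    (N = 17 ∧ ((A = 9 ∧ B = 16) ∨ (A = -15 ∧ B = -16) ∨ (A = 33 ∧ B = 272))) ∨
      (∃ u : ℤ, u % 4 = 3 ∧ (N : ℤ) = u ^ 2 + 64 ∧ A = -u ∧ B = -16) := by
  have hNpos : (0 : ℤ) < N := by exact_mod_cast hN.pos
  have hAodd : Odd A := Int.odd_iff.mpr (by omega)
  have hA2 : A ^ 2 % 4 = 1 := Int.sq_mod_four_eq_one_of_odd hAodd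
  obtain ⟨B', rfl⟩ := hB
  -- `B' ` is even
  have hE : B' ^ 2 * (A ^ 2 - 32 * B') = 4 * (N : ℤ) ^ n ∨
      B' ^ 2 * (A ^ 2 - 32 * B') = -(4 * (N : ℤ) ^ n) := by
    rcases hD with h | h
    · left; exact mul_left_cancel₀ (by norm_num : (64 : ℤ) ≠ 0) (by linear_combination h)
    · right; exact mul_left_cancel₀ (by norm_num : (64 : ℤ) ≠ 0) (by linear_combination h)
  have hB'even : Even B' := by
    by_contra hodd
    rw [Int.not_even_iff_odd] at hodd
    have h1 : Odd (B' ^ 2 * (A ^ 2 - 32 * B')) :=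
      hodd.pow.mul (hAodd.pow.sub_even ⟨16 * B', by ring⟩)
    have h2 : Even (B' ^ 2 * (A ^ 2 - 32 * B')) := by
      rcases hE with h | h <;> rw [h]
      · exact ⟨2 * (N : ℤ) ^ n, by ring⟩
      · exact ⟨-(2 * (N : ℤ) ^ n), by ring⟩
    exact Int.not_even_iff_odd.mpr h1 h2
  obtain ⟨B₀, hB₀⟩ := hB'even
  have hB16 : (8 : ℤ) * B' = 16 * B₀ := by rw [hB₀]; ring
  -- `B₀² (A² − 64 B₀) = ± Nⁿ`
  have hE1 : B₀ ^ 2 * (A ^ 2 - 64 * B₀) = (N : ℤ) ^ n ∨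
      B₀ ^ 2 * (A ^ 2 - 64 * B₀) = -((N : ℤ) ^ n) := by
    rcases hE with h | h <;> rw [hB₀] at h
    · left; exact mul_left_cancel₀ (by norm_num : (4 : ℤ) ≠ 0) (by linear_combination h)
    · right; exact mul_left_cancel₀ (by norm_num : (4 : ℤ) ≠ 0) (by linear_combination h)
  have hC' : ¬ (N : ℤ) ∣ A ^ 2 - 48 * B₀ := by
    intro h; apply hC; rw [hB16]; simpa [mul_comm, mul_left_comm, mul_assoc] using h
  have hdodd : Odd (A ^ 2 - 64 * B₀) := hAodd.pow.sub_even ⟨32 * B₀, by ring⟩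
  rw [hB16]
  -- the prime `2`
  by_cases hN2 : N = 2
  · exfalso
    rw [hN2] at hE1
    push_cast at hE1
    have hd : A ^ 2 - 64 * B₀ ∣ (2 : ℤ) ^ n := by
      rcases hE1 with h | h
      · exact Dvd.intro_left _ h
      · exact dvd_neg.mp (Dvd.intro_left _ h)
    rcases odd_dvd_two_pow hdodd hd with h1 | h1
    · -- `A² − 64 B₀ = 1`: `B₀² = 2ⁿ`, `B₀ = ±2ᵏ`, `(A − 1)(A + 1) = 64 B₀`
      have hsq : B₀ ^ 2 = (2 : ℤ) ^ n := by
        rcases hE1 with h | h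
        · rw [h1, mul_one] at h; exact h
        · rw [h1, mul_one] at h
          have : (0 : ℤ) < 2 ^ n := pow_pos (by norm_num) n
          nlinarith [sq_nonneg B₀]
      have hB₀d : B₀ ∣ (2 : ℤ) ^ n := ⟨B₀, by rw [← hsq]; ring⟩
      obtain ⟨k, hk⟩ := eq_pow_or_neg_pow_of_dvd Nat.prime_two hB₀d
      push_cast at hk
      obtain ⟨a, rfl⟩ := hAodd
      have hk2 : 2 ≤ k + 4 := by omega
      have key : a * (a + 1) = 16 * B₀ := by
        have h4 : (4 : ℤ) * (a * (a + 1)) = 4 * (16 * B₀) := by linear_combination h1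
        exact mul_left_cancel₀ (by norm_num) h4
      refine mul_succ_ne_two_pow (a := a) hk2 ?_
      rcases hk with hk | hk
      · left; rw [pow_add, key, hk]; ring
      · right; rw [pow_add, key, hk]; ring
    · -- `A² − 64 B₀ = −1` is impossible mod `4`
      omega
  -- odd prime
  have hp : Prime (N : ℤ) := Nat.prime_iff_prime_int.mp hN
  have hnotboth : ¬ ((N : ℤ) ∣ B₀ ∧ (N : ℤ) ∣ A ^ 2 - 64 * B₀) := by
    rintro ⟨h1, h2⟩
    apply hC'
    have : A ^ 2 - 48 * B₀ = (A ^ 2 - 64 * B₀) + 16 * B₀ := by ring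
    rw [this]
    exact dvd_add h2 (dvd_mul_of_dvd_right h1 _)
  by_cases hNB : (N : ℤ) ∣ B₀
  · -- then `N ∤ A² − 64B₀`, which divides `± Nⁿ`: it is `±1`
    have hnd : ¬ (N : ℤ) ∣ A ^ 2 - 64 * B₀ := fun h => hnotboth ⟨hNB, h⟩
    have hcop : IsCoprime ((N : ℤ) ^ n) (A ^ 2 - 64 * B₀) :=
      ((Prime.coprime_iff_not_dvd hp).mpr hnd).pow_left
    have hd1 : A ^ 2 - 64 * B₀ ∣ 1 := by
      have hdn : A ^ 2 - 64 * B₀ ∣ (N : ℤ) ^ n * 1 := by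
        rw [mul_one]
        rcases hE1 with h | h
        · exact Dvd.intro_left _ h
        · exact dvd_neg.mp (Dvd.intro_left _ h)
      exact hcop.symm.dvd_of_dvd_mul_left hdn
    rcases Int.isUnit_iff.mp (isUnit_of_dvd_one hd1) with h1 | h1
    · -- `A² − 64B₀ = 1`, `B₀ = ± Nʲ`, `(A − 1)(A + 1) = ± 64 Nʲ`
      have hsq : B₀ ^ 2 = (N : ℤ) ^ n := by
        rcases hE1 with h | h
        · rw [h1, mul_one] at h; exact h
        · rw [h1, mul_one] at h
          have : (0 : ℤ) < (N : ℤ) ^ n := pow_pos hNpos n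
          nlinarith [sq_nonneg B₀]
      have hB₀d : B₀ ∣ (N : ℤ) ^ n := ⟨B₀, by rw [← hsq]; ring⟩
      obtain ⟨j, hj⟩ := eq_pow_or_neg_pow_of_dvd hN hB₀d
      have h33 := sq_sub_one hN hN2 (A := A) (l := j) (by
        rcases hj with hj | hj
        · left; linear_combination h1 + 64 * hj
        · right; linear_combination h1 + 64 * hj)
      obtain ⟨rfl, hA33⟩ := h33
      have hA' : A = 33 := by omega
      subst hA'
      have hB₀' : B₀ = 17 := by omega
      subst hB₀'
      left; exact ⟨rfl, Or.inr (Or.inr ⟨rfl, by norm_num⟩)⟩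
    · exfalso; omega
  · -- `N ∤ B₀`: `B₀ ∣ ± Nⁿ` gives `B₀ = ±1`
    have hcop : IsCoprime ((N : ℤ) ^ n) B₀ := ((Prime.coprime_iff_not_dvd hp).mpr hNB).pow_left
    have hd1 : B₀ ∣ 1 := by
      have hdn : B₀ ∣ (N : ℤ) ^ n * 1 := by
        rw [mul_one]
        rcases hE1 with h | h
        · exact ⟨B₀ * (A ^ 2 - 64 * B₀), by rw [← h]; ring⟩
        · exact ⟨-(B₀ * (A ^ 2 - 64 * B₀)), by linear_combination h⟩
      exact hcop.symm.dvd_of_dvd_mul_left hdn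
    rcases Int.isUnit_iff.mp (isUnit_of_dvd_one hd1) with rfl | rfl
    · -- `B₀ = 1`: `A² − 64 = ± Nⁿ`
      have h9 := sq_sub_sixtyfour hN hN2 (A := A) (l := n) (by
        rcases hE1 with h | h
        · left; linear_combination h
        · right; linear_combination h)
      obtain ⟨rfl, hA9⟩ := h9
      have hA' : A = 9 := by omega
      subst hA'
      left; exact ⟨rfl, Or.inl ⟨rfl, by norm_num⟩⟩
    · -- `B₀ = −1`: `A² + 64 = Nⁿ` — the Lebesgue–Nagell equation
      have hLN : A ^ 2 + 64 = (N : ℤ) ^ n := by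
        rcases hE1 with h | h
        · linear_combination h
        · have : (0 : ℤ) < (N : ℤ) ^ n := pow_pos hNpos n
          nlinarith [sq_nonneg A]
      rcases Literature.NumberTheory.DiophantineGeometry.sq_add_sixtyfour_eq_prime_pow hN hN2 n A hLN
        with rfl | ⟨rfl, rfl⟩
      · -- `n = 1`: the Neumann–Setzer case
        right
        refine ⟨-A, by omega, by linear_combination -hLN, by ring, by norm_num⟩
      · -- `n = 2`, `N = 17`: `A = ±15`
        have hA15 := eq_of_sq_eq_225 (A := A) (by linear_combination hLN)
        have hA' : A = -15 := by omega
        subst hA'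
        left; exact ⟨rfl, Or.inr (Or.inl ⟨rfl, by norm_num⟩)⟩

/-! ## §3 Type II: `B` odd, `A = 2A₁`, `A₁ ≡ 3 (mod 4)` -/

/-- **Type II classification.** [cite: Setzer1975, Thm 2 (proof, the case of a `2`-torsion model with `B` odd); cf. Ivorra2004, §2] -/
theorem classify_typeII {N : ℕ} (hN : N.Prime) {A₁ B : ℤ} {n : ℕ} (hn : 1 ≤ n)
    (hD : B ^ 2 * ((2 * A₁) ^ 2 - 4 * B) = 2 ^ 8 * (N : ℤ) ^ n ∨
      B ^ 2 * ((2 * A₁) ^ 2 - 4 * B) = -(2 ^ 8 * (N : ℤ) ^ n))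
    (hC : ¬ (N : ℤ) ∣ (2 * A₁) ^ 2 - 3 * B) (hA : A₁ % 4 = 3) (hB : Odd B) :
    (N = 17 ∧ ((A₁ = -33 ∧ B = 1) ∨ (A₁ = -9 ∧ B = 17) ∨ (A₁ = 15 ∧ B = 289))) ∨
      (∃ u : ℤ, u % 4 = 3 ∧ (N : ℤ) = u ^ 2 + 64 ∧ A₁ = u ∧ B = u ^ 2 + 64) := by
  have hNpos : (0 : ℤ) < N := by exact_mod_cast hN.pos
  have hAodd : Odd A₁ := Int.odd_iff.mpr (by omega)
  have hA2 : A₁ ^ 2 % 4 = 1 := Int.sq_mod_four_eq_one_of_odd hAodd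
  -- `B² (A₁² − B) = ± 64 Nⁿ`
  have hE2 : B ^ 2 * (A₁ ^ 2 - B) = 64 * (N : ℤ) ^ n ∨
      B ^ 2 * (A₁ ^ 2 - B) = -(64 * (N : ℤ) ^ n) := by
    rcases hD with h | h
    · left; exact mul_left_cancel₀ (by norm_num : (4 : ℤ) ≠ 0) (by linear_combination h)
    · right; exact mul_left_cancel₀ (by norm_num : (4 : ℤ) ≠ 0) (by linear_combination h)
  have hBd0 : B ∣ B ^ 2 * (A₁ ^ 2 - B) := Dvd.intro (B * (A₁ ^ 2 - B)) (by ring)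
  have hBd : B ∣ 64 * (N : ℤ) ^ n := by
    rcases hE2 with h | h
    · rwa [h] at hBd0
    · rw [h] at hBd0; exact dvd_neg.mp hBd0
  -- the prime `2`
  by_cases hN2 : N = 2
  · exfalso
    rw [hN2] at hE2 hBd
    push_cast at hE2 hBd
    have h64 : (64 : ℤ) * 2 ^ n = 2 ^ (n + 6) := by rw [pow_add]; ring
    rw [h64] at hBd
    rcases odd_dvd_two_pow hB hBd with rfl | rfl
    · -- `B = 1`: `(A₁ − 1)(A₁ + 1) = ± 2ⁿ⁺⁶`
      obtain ⟨a, rfl⟩ := hAodd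
      refine mul_succ_ne_two_pow (a := a) (k := n + 4) (by omega) ?_
      rcases hE2 with h | h
      · left
        have h4 : (4 : ℤ) * (a * (a + 1)) = 4 * 2 ^ (n + 4) := by
          rw [pow_add]; linear_combination h
        exact mul_left_cancel₀ (by norm_num) h4
      · right
        have h4 : (4 : ℤ) * (a * (a + 1)) = 4 * -(2 ^ (n + 4)) := by
          rw [pow_add]; linear_combination h
        exact mul_left_cancel₀ (by norm_num) h4
    · -- `B = −1`: `A₁² + 1 = ± 2ⁿ⁺⁶` is impossible mod `4`
      have h4 : (4 : ℤ) ∣ 64 * 2 ^ n := ⟨16 * 2 ^ n, by ring⟩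
      generalize (64 : ℤ) * 2 ^ n = T at hE2 h4
      generalize A₁ ^ 2 = X at hA2 hE2
      rcases hE2 with h | h
      · have : X + 1 = T := by linear_combination h
        omega
      · have : X + 1 = -T := by linear_combination h
        omega
  -- odd prime
  have hp : Prime (N : ℤ) := Nat.prime_iff_prime_int.mp hN
  have hnotboth : ¬ ((N : ℤ) ∣ B ∧ (N : ℤ) ∣ A₁ ^ 2 - B) := by
    rintro ⟨h1, h2⟩
    apply hC
    have : (2 * A₁) ^ 2 - 3 * B = 4 * (A₁ ^ 2 - B) + B := by ring
    rw [this]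
    exact dvd_add (dvd_mul_of_dvd_right h2 _) h1
  by_cases hNB : (N : ℤ) ∣ B
  · -- `N ∤ A₁² − B`, which divides `64 Nⁿ`: it divides `64`; `B` odd forces `A₁² − B = ±64`
    have hnd : ¬ (N : ℤ) ∣ A₁ ^ 2 - B := fun h => hnotboth ⟨hNB, h⟩
    have hcop : IsCoprime ((N : ℤ) ^ n) (A₁ ^ 2 - B) :=
      ((Prime.coprime_iff_not_dvd hp).mpr hnd).pow_left
    have hd64 : A₁ ^ 2 - B ∣ 64 := by
      have hdn : A₁ ^ 2 - B ∣ 64 * (N : ℤ) ^ n := by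
        rcases hE2 with h | h
        · exact Dvd.intro_left _ h
        · exact dvd_neg.mp (Dvd.intro_left _ h)
      exact hcop.symm.dvd_of_dvd_mul_right hdn
    have h64d : (64 : ℤ) ∣ A₁ ^ 2 - B := by
      have hcop2 : IsCoprime ((2 : ℤ) ^ 6) (B ^ 2) :=
        ((Prime.coprime_iff_not_dvd Int.prime_two).mpr
          (by rw [← even_iff_two_dvd, Int.not_even_iff_odd]; exact hB.pow)).pow_left
      have h2 : (2 : ℤ) ^ 6 ∣ B ^ 2 * (A₁ ^ 2 - B) := by
        rcases hE2 with h | h <;> rw [h]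
        · exact ⟨(N : ℤ) ^ n, by ring⟩
        · exact ⟨-((N : ℤ) ^ n), by ring⟩
      have := hcop2.dvd_of_dvd_mul_left h2
      norm_num at this
      exact this
    have hdabs : (A₁ ^ 2 - B).natAbs = 64 := by
      apply Nat.dvd_antisymm
      · simpa using Int.natAbs_dvd_natAbs.mpr hd64
      · simpa using Int.natAbs_dvd_natAbs.mpr h64d
    -- `B² = Nⁿ`, so `B = ± Nʲ`
    have hsq : B ^ 2 = (N : ℤ) ^ n := by
      have hNn : (0 : ℤ) < (N : ℤ) ^ n := pow_pos hNpos n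
      rcases Int.natAbs_eq_iff.mp hdabs with hd | hd <;> push_cast at hd <;>
        rcases hE2 with h | h <;> rw [hd] at h <;> nlinarith [sq_nonneg B]
    have hBdN : B ∣ (N : ℤ) ^ n := ⟨B, by rw [← hsq]; ring⟩
    obtain ⟨j, hj⟩ := eq_pow_or_neg_pow_of_dvd hN hBdN
    rcases Int.natAbs_eq_iff.mp hdabs with hd | hd <;> push_cast at hd
    · -- `A₁² − B = 64`: `B = (A₁ − 8)(A₁ + 8) = ± Nʲ`
      have h9 := sq_sub_sixtyfour hN hN2 (A := A₁) (l := j) (by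
        rcases hj with hj | hj
        · left; linear_combination hj + hd
        · right; linear_combination hj + hd)
      obtain ⟨rfl, hA9⟩ := h9
      have hA' : A₁ = -9 := by omega
      subst hA'
      have hB' : B = 17 := by omega
      subst hB'
      left; exact ⟨rfl, Or.inr (Or.inl ⟨rfl, rfl⟩)⟩
    · -- `A₁² − B = −64`: `B = A₁² + 64 = Nʲ` — the Lebesgue–Nagell equation
      have hBpos : 0 < B := by nlinarith [sq_nonneg A₁]
      have hLN : A₁ ^ 2 + 64 = (N : ℤ) ^ j := by
        rcases hj with hj | hj
        · linear_combination hj + hd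
        · have : (0 : ℤ) < (N : ℤ) ^ j := pow_pos hNpos j
          exfalso; linarith
      rcases Literature.NumberTheory.DiophantineGeometry.sq_add_sixtyfour_eq_prime_pow hN hN2 j A₁ hLN
        with rfl | ⟨rfl, rfl⟩
      · -- `j = 1`: the Neumann–Setzer case
        right
        refine ⟨A₁, hA, by linear_combination -hLN, rfl, by linear_combination -hd⟩
      · -- `j = 2`, `N = 17`: `A₁ = 15`
        have hA15 := eq_of_sq_eq_225 (A := A₁) (by linear_combination hLN)
        have hA' : A₁ = 15 := by omega
        subst hA'
        have hB' : B = 289 := by omega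
        subst hB'
        left; exact ⟨rfl, Or.inr (Or.inr ⟨rfl, rfl⟩)⟩
  · -- `N ∤ B`: `B ∣ 64 Nⁿ` is coprime to `N`, so `B ∣ 64`, and `B` odd gives `B = ±1`
    have hcop : IsCoprime ((N : ℤ) ^ n) B := ((Prime.coprime_iff_not_dvd hp).mpr hNB).pow_left
    have hB64 : B ∣ (2 : ℤ) ^ 6 := by
      have := hcop.symm.dvd_of_dvd_mul_right hBd
      norm_num
      exact this
    rcases odd_dvd_two_pow hB hB64 with rfl | rfl
    · -- `B = 1`: `(A₁ − 1)(A₁ + 1) = ± 64 Nⁿ`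
      have h33 := sq_sub_one hN hN2 (A := A₁) (l := n) (by
        rcases hE2 with h | h
        · left; linear_combination h
        · right; linear_combination h)
      obtain ⟨rfl, hA33⟩ := h33
      have hA' : A₁ = -33 := by omega
      subst hA'
      left; exact ⟨rfl, Or.inl ⟨rfl, rfl⟩⟩
    · -- `B = −1`: `A₁² + 1 = ± 64 Nⁿ` is impossible mod `4`
      exfalso
      have h4 : (4 : ℤ) ∣ 64 * (N : ℤ) ^ n := ⟨16 * (N : ℤ) ^ n, by ring⟩
      generalize (64 : ℤ) * (N : ℤ) ^ n = T at hE2 h4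
      generalize A₁ ^ 2 = X at hA2 hE2
      rcases hE2 with h | h
      · have : X + 1 = T := by linear_combination h
        omega
      · have : X + 1 = -T := by linear_combination h
        omega

/-! ## §4 The classification of the `2`-torsion normal forms of prime conductor -/

/-- **Setzer's list.** For a prime `p` and a `2`-torsion normal form `y² = x³ + Ax² + Bx` with
`B²(A² − 4B) = ±2⁸pⁿ` (`n ≥ 1`), `p ∤ A² − 3B`, of `2`-adic type I or II: either `p = 17` and
`(A, B)` is one of `(9, 16), (−15, −16), (33, 272), (−66, 1), (−18, 17), (30, 289)`, or
`p = u² + 64` with `u ≡ 3 (mod 4)` and `(A, B) = (−u, −16)` (the curve `E₁(u)`: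
`y² = x³ − ux² − 16x`) or `(A, B) = (2u, u² + 64)` (the curve `E₀(u)`: `y² = x³ + 2ux² + px`).
[cite: Setzer1975, Thm 2] [cite: Ivorra2004, Introduction, Théorème (p. 5)] -/
theorem classify {N : ℕ} (hN : N.Prime) {A B : ℤ} {n : ℕ} (hn : 1 ≤ n)
    (hD : B ^ 2 * (A ^ 2 - 4 * B) = 2 ^ 8 * (N : ℤ) ^ n ∨
      B ^ 2 * (A ^ 2 - 4 * B) = -(2 ^ 8 * (N : ℤ) ^ n))
    (hC : ¬ (N : ℤ) ∣ A ^ 2 - 3 * B)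
    (hT : (A % 4 = 1 ∧ (8 : ℤ) ∣ B) ∨ (Odd B ∧ ∃ A₁ : ℤ, A = 2 * A₁ ∧ A₁ % 4 = 3)) :
    (N = 17 ∧ ((A = 9 ∧ B = 16) ∨ (A = -15 ∧ B = -16) ∨ (A = 33 ∧ B = 272) ∨
      (A = -66 ∧ B = 1) ∨ (A = -18 ∧ B = 17) ∨ (A = 30 ∧ B = 289))) ∨
    (∃ u : ℤ, u % 4 = 3 ∧ (N : ℤ) = u ^ 2 + 64 ∧
      ((A = -u ∧ B = -16) ∨ (A = 2 * u ∧ B = u ^ 2 + 64))) := by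
  rcases hT with ⟨hA, hB⟩ | ⟨hB, A₁, rfl, hA⟩
  · rcases classify_typeI hN hn hD hC hA hB with ⟨h17, h⟩ | ⟨u, hu, hNu, hAu, hBu⟩
    · left
      refine ⟨h17, ?_⟩
      rcases h with h | h | h
      · exact Or.inl h
      · exact Or.inr (Or.inl h)
      · exact Or.inr (Or.inr (Or.inl h))
    · exact Or.inr ⟨u, hu, hNu, Or.inl ⟨hAu, hBu⟩⟩
  · rcases classify_typeII hN hn hD hC hA hB with ⟨h17, h⟩ | ⟨u, hu, hNu, hAu, hBu⟩
    · left
      refine ⟨h17, ?_⟩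
      rcases h with ⟨h1, h2⟩ | ⟨h1, h2⟩ | ⟨h1, h2⟩
      · exact Or.inr (Or.inr (Or.inr (Or.inl ⟨by omega, h2⟩)))
      · exact Or.inr (Or.inr (Or.inr (Or.inr (Or.inl ⟨by omega, h2⟩))))
      · exact Or.inr (Or.inr (Or.inr (Or.inr (Or.inr ⟨by omega, h2⟩))))
    · exact Or.inr ⟨u, hu, hNu, Or.inr ⟨by omega, hBu⟩⟩

/-! ## §5 The explicit isomorphisms -/

/-- **Identifying a `2`-torsion normal form with a given curve.** If `C₂ • W = ⟨0, A, 0, B, 0⟩` and a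
target curve `T` has a rational point `(x₀, y₀)` of order `2` whose own normal form
(`smul_eq_twoTorsionModel`) is the same `⟨0, A, 0, B, 0⟩`, then `W ≅ T` over `ℚ`.
[cite: SilvermanAEC2009, III.1 Table 3.1 (composition and inversion of admissible changes of variables)] -/
theorem exists_smul_eq_of_twoTorsionModel {W T : WeierstrassCurve ℚ} {A B : ℚ}
    (C₂ : VariableChange ℚ) (hW : C₂ • W = ⟨0, A, 0, B, 0⟩) {x₀ y₀ : ℚ}
    (heq : T.toAffine.Equation x₀ y₀) (h2 : 2 * y₀ + T.a₁ * x₀ + T.a₃ = 0)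
    (hA : T.b₂ + 3 * (4 * x₀) = A) (hB : 3 * (4 * x₀) ^ 2 + 2 * T.b₂ * (4 * x₀) + 8 * T.b₄ = B) :
    ∃ C : VariableChange ℚ, C • W = T := by
  refine ⟨(⟨⟨1 / 2, 2, by norm_num, by norm_num⟩, x₀, -T.a₁ / 2, y₀⟩ : VariableChange ℚ)⁻¹ * C₂, ?_⟩
  rw [mul_smul, hW, ← hA, ← hB, ← smul_eq_twoTorsionModel T heq h2, inv_smul_smul]

/-- `y² = x³ − ux² − 16x` is `ℚ`-isomorphic to the Neumann–Setzer curve `E₁(u)` (its `2`-torsion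
point is `(0, 0)`). [cite: Mazur1977, III §7 (p. 162: "x ↦ 4x carries E₁(u) to y² = x³ − ux² − 16x")] -/
theorem exists_smul_eq_neumannSetzerCurve₁ {W : WeierstrassCurve ℚ} (u : ℤ) (C₂ : VariableChange ℚ)
    (hW : C₂ • W = ⟨0, -(u : ℚ), 0, -16, 0⟩) :
    ∃ C : VariableChange ℚ, C • W = neumannSetzerCurve₁ u := by
  refine exists_smul_eq_of_twoTorsionModel C₂ hW (x₀ := 0) (y₀ := 0) ?_ ?_ ?_ ?_
  · rw [WeierstrassCurve.Affine.equation_iff]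
    simp [neumannSetzerCurve₁]
  · simp [neumannSetzerCurve₁]
  · simp only [neumannSetzerCurve₁, WeierstrassCurve.b₂]
    ring
  · simp only [neumannSetzerCurve₁, WeierstrassCurve.b₂, WeierstrassCurve.b₄]
    ring

/-- `y² = x³ + 2ux² + (u² + 64)x` is `ℚ`-isomorphic to the Neumann–Setzer curve `E₀(u)` (its
`2`-torsion point is `(u/4, −u/8)`). [cite: Mazur1977, III §7 (p. 162)] [cite: SteinWatkins2004, §1 eq. (1) (PDF p. 3)] -/
theorem exists_smul_eq_neumannSetzerCurve₀ {W : WeierstrassCurve ℚ} (u : ℤ) (C₂ : VariableChange ℚ)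
    (hW : C₂ • W = ⟨0, 2 * (u : ℚ), 0, (u : ℚ) ^ 2 + 64, 0⟩) :
    ∃ C : VariableChange ℚ, C • W = neumannSetzerCurve₀ u := by
  refine exists_smul_eq_of_twoTorsionModel C₂ hW (x₀ := (u : ℚ) / 4) (y₀ := -((u : ℚ) / 8))
    ?_ ?_ ?_ ?_
  · rw [WeierstrassCurve.Affine.equation_iff]
    simp only [neumannSetzerCurve₀]
    ring
  · simp only [neumannSetzerCurve₀]
    ring
  · simp only [neumannSetzerCurve₀, WeierstrassCurve.b₂]
    ring
  · simp only [neumannSetzerCurve₀, WeierstrassCurve.b₂, WeierstrassCurve.b₄]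
    ring

end PrimeConductorTwoTorsion

/-! ## §6 Setzer's theorem -/

open PrimeConductorTwoTorsion Greenberg1999 in
/-- **Setzer's theorem** (discharge of the named fact
`Setzer1975_primeConductor_rationalTwoTorsion`): an elliptic curve over `ℚ` of prime conductor `N`
with a rational point of order `2` has `N = 17`, or `N = u² + 64` with `u ≡ 3 (mod 4)` and is
`ℚ`-isomorphic to `E₀(u)` or `E₁(u)`.
[cite: Setzer1975, Thm 2] [cite: Ivorra2004, Introduction, Théorème (p. 5)] [cite: Mazur1977, III §7 (p. 162)] -/
theorem Setzer1975_primeConductor_rationalTwoTorsion_holds :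
    Setzer1975_primeConductor_rationalTwoTorsion := by
  intro W _ x hx hN
  obtain ⟨C₂, A, B, n, hW, hn, hD, hC, hT⟩ := exists_normalForm_of_prime_conductorNorm W hN hx
  rcases classify hN hn hD hC hT with ⟨h17, -⟩ | ⟨u, hu4, hNu, hAB⟩
  · exact Or.inl h17
  · refine Or.inr ⟨u, hu4, hNu, ?_⟩
    rcases hAB with ⟨rfl, rfl⟩ | ⟨rfl, rfl⟩
    · obtain ⟨C, hC⟩ := exists_smul_eq_neumannSetzerCurve₁ u C₂ (by simpa using hW)
      exact ⟨C, Or.inr hC⟩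
    · obtain ⟨C, hC⟩ := exists_smul_eq_neumannSetzerCurve₀ u C₂ (by simpa using hW)
      exact ⟨C, Or.inl hC⟩

/-! ## §7 Conductor `17` -/

open PrimeConductorTwoTorsion Greenberg1999 in
/-- **The curves of conductor `17` with a rational point of order `2`** (Setzer's complement at
`p = 17`; Cremona's table): such a curve is `ℚ`-isomorphic to one of `17a1 = [1, −1, 1, −1, −14]`,
`17a2 = [1, −1, 1, −6, −4]`, `17a3 = [1, −1, 1, −91, −310]`, `17a4 = [1, −1, 1, −1, 0]` (the six
normal forms at `17` of `classify`: `(30, 289) ≅ 17a1`; `(−15, −16), (33, 272), (−18, 17) ≅ 17a2`,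
one for each of its three points of order `2`; `(−66, 1) ≅ 17a3`; `(9, 16) ≅ 17a4`).
[cite: Setzer1975, Thm 2 and §4 (the curves of conductor 17)] [cite: Cremona1997, Table 1, N = 17 (17a1–17a4)] [cite: Ivorra2004, Introduction (p. 5)] -/
theorem exists_smul_eq_of_conductorNorm_eq_seventeen :
    ∀ (V : WeierstrassCurve ℚ) [V.IsElliptic] (z : ℚ), HasRationalTwoTorsionX V z →
      V.conductorNorm ℤ = 17 →
        ∃ C : WeierstrassCurve.VariableChange ℚ,
          C • V = (⟨1, -1, 1, -1, -14⟩ : WeierstrassCurve ℚ) ∨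
            C • V = (⟨1, -1, 1, -6, -4⟩ : WeierstrassCurve ℚ) ∨
              C • V = (⟨1, -1, 1, -91, -310⟩ : WeierstrassCurve ℚ) ∨
                C • V = (⟨1, -1, 1, -1, 0⟩ : WeierstrassCurve ℚ) := by
  intro V _ z hz h17
  have hN : (V.conductorNorm ℤ).Prime := by rw [h17]; norm_num
  obtain ⟨C₂, A, B, n, hW, hn, hD, hC, hT⟩ := exists_normalForm_of_prime_conductorNorm V hN hz
  rw [h17] at hD hC
  rcases classify (by norm_num : Nat.Prime 17) hn hD hC hT with ⟨-, hAB⟩ | ⟨u, -, hu, -⟩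
  · rcases hAB with ⟨rfl, rfl⟩ | ⟨rfl, rfl⟩ | ⟨rfl, rfl⟩ | ⟨rfl, rfl⟩ | ⟨rfl, rfl⟩ | ⟨rfl, rfl⟩
    · -- `(9, 16) ≅ 17a4`, `2`-torsion point `(1, −1)`
      obtain ⟨C, hC⟩ := exists_smul_eq_of_twoTorsionModel (T := ⟨1, -1, 1, -1, 0⟩) C₂
        (by simpa using hW) (x₀ := 1) (y₀ := -1)
        (by rw [WeierstrassCurve.Affine.equation_iff]; norm_num) (by norm_num)
        (by norm_num [WeierstrassCurve.b₂]) (by norm_num [WeierstrassCurve.b₂, WeierstrassCurve.b₄])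
      exact ⟨C, Or.inr (Or.inr (Or.inr hC))⟩
    · -- `(−15, −16) ≅ 17a2`, `2`-torsion point `(−1, 0)`
      obtain ⟨C, hC⟩ := exists_smul_eq_of_twoTorsionModel (T := ⟨1, -1, 1, -6, -4⟩) C₂
        (by simpa using hW) (x₀ := -1) (y₀ := 0)
        (by rw [WeierstrassCurve.Affine.equation_iff]; norm_num) (by norm_num)
        (by norm_num [WeierstrassCurve.b₂]) (by norm_num [WeierstrassCurve.b₂, WeierstrassCurve.b₄])
      exact ⟨C, Or.inr (Or.inl hC)⟩
    · -- `(33, 272) ≅ 17a2`, `2`-torsion point `(3, −2)`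
      obtain ⟨C, hC⟩ := exists_smul_eq_of_twoTorsionModel (T := ⟨1, -1, 1, -6, -4⟩) C₂
        (by simpa using hW) (x₀ := 3) (y₀ := -2)
        (by rw [WeierstrassCurve.Affine.equation_iff]; norm_num) (by norm_num)
        (by norm_num [WeierstrassCurve.b₂]) (by norm_num [WeierstrassCurve.b₂, WeierstrassCurve.b₄])
      exact ⟨C, Or.inr (Or.inl hC)⟩
    · -- `(−66, 1) ≅ 17a3`, `2`-torsion point `(−21/4, 17/8)`
      obtain ⟨C, hC⟩ := exists_smul_eq_of_twoTorsionModel (T := ⟨1, -1, 1, -91, -310⟩) C₂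
        (by simpa using hW) (x₀ := -21 / 4) (y₀ := 17 / 8)
        (by rw [WeierstrassCurve.Affine.equation_iff]; norm_num) (by norm_num)
        (by norm_num [WeierstrassCurve.b₂]) (by norm_num [WeierstrassCurve.b₂, WeierstrassCurve.b₄])
      exact ⟨C, Or.inr (Or.inr (Or.inl hC))⟩
    · -- `(−18, 17) ≅ 17a2`, `2`-torsion point `(−5/4, 1/8)`
      obtain ⟨C, hC⟩ := exists_smul_eq_of_twoTorsionModel (T := ⟨1, -1, 1, -6, -4⟩) C₂
        (by simpa using hW) (x₀ := -5 / 4) (y₀ := 1 / 8)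
        (by rw [WeierstrassCurve.Affine.equation_iff]; norm_num) (by norm_num)
        (by norm_num [WeierstrassCurve.b₂]) (by norm_num [WeierstrassCurve.b₂, WeierstrassCurve.b₄])
      exact ⟨C, Or.inr (Or.inl hC)⟩
    · -- `(30, 289) ≅ 17a1`, `2`-torsion point `(11/4, −15/8)`
      obtain ⟨C, hC⟩ := exists_smul_eq_of_twoTorsionModel (T := ⟨1, -1, 1, -1, -14⟩) C₂
        (by simpa using hW) (x₀ := 11 / 4) (y₀ := -15 / 8)
        (by rw [WeierstrassCurve.Affine.equation_iff]; norm_num) (by norm_num)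
        (by norm_num [WeierstrassCurve.b₂]) (by norm_num [WeierstrassCurve.b₂, WeierstrassCurve.b₄])
      exact ⟨C, Or.inl hC⟩
  · -- `17 = u² + 64` is impossible
    exfalso
    push_cast at hu
    nlinarith [sq_nonneg u]

end Literature.NumberTheory.EllipticCurves
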